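import Summits.CriticalPhenomena.PercolationContinuityZ3.Theorems.PercNearOneGluingNoHeavyLowerTailSahiTwoChainWRSymmetry
import HarnessLib

/-!
# The without-replacement two-chain functional `Ẽ_n`: transport along injections, deletion averaging, the chain case

Support file of the one-cut programme (crux `NoHeavyLowerTail`, stmt-CriticalPhenomena-4575; cell `prim-masterthm`, seat P3, gen 16;
`run/shared/lean/prim/prim-masterthm/prim-masterthm-p3/HIERARCHY.md` §24; memo
`run/shared/lean/prim/prim-masterthm/FROM-prim-masterthm-p3-g16-TWO-CHAIN-COEFFICIENTS.md`).

Three structural facts about `SahiTwoChain.et` (`…SahiTwoChainWRDefs`), all by induction along its recursion: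
* **`et_comp_map`** — transport: for injections `eα : α' ↪ α`, `eβ : β' ↪ β`, `Ẽ` of the pulled-back family on `X' × Y'` is `Ẽ` of the
  family on the image grid `eα(X') × eβ(Y')`; hence invariance under (row permutation × column permutation) of a full grid
  (`et_comp_equiv`) — the symmetry of the random partial permutation pattern that replaces Lieb–Sahi's "little squares have equal
  mass" [LiebSahi2021, Lemma 2.5] — and the identification of a reduced grid with a smaller full grid (`et_erase_eq_of_map`).
* **`et_sum_erase`** — deletion averaging: with a spare row and column, the average of `Ẽ_n` over the `|X||Y|` reduced grids is `Ẽ_n`.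
* **`et_eq_chainAvg`**, `chainAvg_sum_erase`, `chainAvg_nonneg` — THE CHAIN CASE: for an absorbing family of functions of the second
  coordinate (indicators of nested full-width bands) `Ẽ_n = chainAvg ≥ 0`; the without-replacement form of the Lieb–Sahi chain
  product formula [LiebSahi2021, Lemma 3.2] (= nonnegativity of the polarised `E_n` on nested hold-sets, memo of gen 15 §2).
Everything PROVED, standard axioms; no new definitions. [this work]
-/

noncomputable section

open scoped Classical

namespace Summit.CriticalPhenomena.PercolationContinuityZ3.Theorems

open Finset Function
open Literature.Combinatorics.Sahi2008

namespace SahiTwoChain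

variable {α β : Type*}

/-! ### Invariance: transporting the grid along injections -/

/-- Sums over a product of mapped finsets (plumbing). [this work] -/
theorem sum_product_map {α' β' : Type*} (eα : α' ↪ α) (eβ : β' ↪ β) (X' : Finset α') (Y' : Finset β')
    (F : α × β → ℝ) :
    ∑ z ∈ (X'.map eα) ×ˢ (Y'.map eβ), F z = ∑ z' ∈ X' ×ˢ Y', F (eα z'.1, eβ z'.2) := by
  rw [Finset.sum_product, Finset.sum_product, Finset.sum_map]
  exact sum_congr rfl fun x _ => by rw [Finset.sum_map]

/-- **Transport of `Ẽ_n` along injections of the two coordinates**: pulling the functions back along `eα × eβ` and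
computing on `X' × Y'` is computing on the image grid `eα(X') × eβ(Y')`. [this work] -/
theorem et_comp_map {α' β' : Type*} (eα : α' ↪ α) (eβ : β' ↪ β) :
    ∀ (n : ℕ) (X' : Finset α') (Y' : Finset β') (f : Fin n → α × β → ℝ),
      et X' Y' n (fun i => f i ∘ Prod.map eα eβ) = et (X'.map eα) (Y'.map eβ) n f
  | 0, _, _, _ => rfl
  | 1, X', Y', f => by
    rw [et_one, et_one, card_map, card_map, sum_product_map]
    rfl
  | n + 2, X', Y', f => by
    rw [et_succ_succ, et_succ_succ, card_map, card_map, sum_product_map]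
    have htail' : (Fin.tail fun i => f i ∘ Prod.map eα eβ) = fun j => Fin.tail f j ∘ Prod.map eα eβ := rfl
    have htail : ∀ i : Fin (n + 1),
        update (fun j => Fin.tail f j ∘ Prod.map eα eβ) i (Fin.tail f i ∘ Prod.map eα eβ * f 0 ∘ Prod.map eα eβ) =
          fun j => update (Fin.tail f) i (Fin.tail f i * f 0) j ∘ Prod.map eα eβ := by
      intro i
      funext j
      by_cases hj : j = i
      · subst hj
        simp only [update_self]
        rfl
      · simp only [update_of_ne hj]
    rw [htail']
    simp only [htail, et_comp_map eα eβ (n + 1), Finset.map_erase]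
    rfl

/-- Transport along a pair of equivalences onto full grids: `Ẽ` on `univ × univ` of the pulled-back family equals `Ẽ` on
`univ × univ`. [this work] -/
theorem et_comp_equiv {α' β' : Type*} [Fintype α] [Fintype β] [Fintype α'] [Fintype β'] (eα : α' ≃ α) (eβ : β' ≃ β)
    (n : ℕ) (f : Fin n → α × β → ℝ) :
    et (univ : Finset α') (univ : Finset β') n (fun i => f i ∘ Prod.map eα eβ) = et (univ : Finset α) univ n f := by
  have h := et_comp_map eα.toEmbedding eβ.toEmbedding n univ univ f
  rw [Finset.map_univ_equiv, Finset.map_univ_equiv] at h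
  exact h

/-- A reduced grid is the image of a smaller grid: `Ẽ` on `(X∖x) × (Y∖y)` computed through any injections `eα, eβ`
with images `X∖x`, `Y∖y` (used with `Fin.succAbove`). [this work] -/
theorem et_erase_eq_of_map {α' β' : Type*} (eα : α' ↪ α) (eβ : β' ↪ β) (X' : Finset α') (Y' : Finset β')
    (X : Finset α) (Y : Finset β) (x : α) (y : β) (hX : X'.map eα = X.erase x) (hY : Y'.map eβ = Y.erase y)
    (n : ℕ) (f : Fin n → α × β → ℝ) :
    et (X.erase x) (Y.erase y) n f = et X' Y' n (fun i => f i ∘ Prod.map eα eβ) := by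
  rw [et_comp_map, hX, hY]

/-! ### Deletion averaging: a uniformly deleted row and column -/

/-- **Deletion averaging.**  If the grid has a spare row and column (`n + 1 ≤ |X|, |Y|`), then averaging `Ẽ_n` over the
`|X||Y|` reduced grids `(X∖x) × (Y∖y)` gives back `Ẽ_n` on `X × Y` (a uniformly random pattern of the reduced grid, for a
uniformly deleted point, is a uniformly random pattern). [this work] -/
theorem et_sum_erase : ∀ (n : ℕ) (X : Finset α) (Y : Finset β) (f : Fin n → α × β → ℝ),
    n + 1 ≤ X.card → n + 1 ≤ Y.card →
      ∑ z ∈ X ×ˢ Y, et (X.erase z.1) (Y.erase z.2) n f = ((X.card : ℝ) * Y.card) * et X Y n f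
  | 0, X, Y, f, _, _ => by simp [et_zero]
  | 1, X, Y, f, hX, hY => by
    have hX0 : (X.card : ℝ) ≠ 0 := by exact_mod_cast (show X.card ≠ 0 by omega)
    have hY0 : (Y.card : ℝ) ≠ 0 := by exact_mod_cast (show Y.card ≠ 0 by omega)
    simp only [et_one]
    rw [mul_div_cancel₀ _ (mul_ne_zero hX0 hY0)]
    have h1 : ∀ z ∈ X ×ˢ Y, (∑ z' ∈ (X.erase z.1) ×ˢ (Y.erase z.2), f 0 z') / (((X.erase z.1).card : ℝ) * (Y.erase z.2).card)
        = (∑ z' ∈ (X.erase z.1) ×ˢ (Y.erase z.2), f 0 z') / (((X.card - 1 : ℕ) : ℝ) * ((Y.card - 1 : ℕ) : ℝ)) := by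
      intro z hz
      rw [card_erase_mul_card_erase hz]
    rw [sum_congr rfl h1, ← sum_div, sum_offGrid_comm]
    have h2 : ∀ z ∈ X ×ˢ Y, ∑ z' ∈ (X.erase z.1) ×ˢ (Y.erase z.2), f 0 z =
        (((X.card - 1 : ℕ) : ℝ) * ((Y.card - 1 : ℕ) : ℝ)) * f 0 z := by
      intro z hz
      rw [sum_const, card_product, nsmul_eq_mul, Nat.cast_mul, ← card_erase_mul_card_erase hz]
    have h3 : ((X.card - 1 : ℕ) : ℝ) ≠ 0 := by exact_mod_cast (show X.card - 1 ≠ 0 by omega)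
    have h4 : ((Y.card - 1 : ℕ) : ℝ) ≠ 0 := by exact_mod_cast (show Y.card - 1 ≠ 0 by omega)
    rw [sum_congr rfl h2, ← mul_sum, mul_div_cancel_left₀ _ (mul_ne_zero h3 h4)]
  | n + 2, X, Y, f, hX, hY => by
    have hX0 : (X.card : ℝ) ≠ 0 := by exact_mod_cast (show X.card ≠ 0 by omega)
    have hY0 : (Y.card : ℝ) ≠ 0 := by exact_mod_cast (show Y.card ≠ 0 by omega)
    have h3 : ((X.card - 1 : ℕ) : ℝ) ≠ 0 := by exact_mod_cast (show X.card - 1 ≠ 0 by omega)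
    have h4 : ((Y.card - 1 : ℕ) : ℝ) ≠ 0 := by exact_mod_cast (show Y.card - 1 ≠ 0 by omega)
    -- expand every reduced-grid `Ẽ_{n+2}` by the recursion
    simp only [et_succ_succ]
    rw [sum_sub_distrib, sum_comm]
    -- first group: deletion averaging one level down, slot by slot
    have hA : ∀ i : Fin (n + 1), ∑ z ∈ X ×ˢ Y, et (X.erase z.1) (Y.erase z.2) (n + 1)
        (update (Fin.tail f) i (Fin.tail f i * f 0)) =
        ((X.card : ℝ) * Y.card) * et X Y (n + 1) (update (Fin.tail f) i (Fin.tail f i * f 0)) :=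
      fun i => et_sum_erase (n + 1) X Y _ (by omega) (by omega)
    simp only [hA]
    rw [← mul_sum]
    -- second group: normalise the denominators, exchange the two deleted points, and average one level down
    have hB : ∀ z ∈ X ×ˢ Y, (∑ z' ∈ (X.erase z.1) ×ˢ (Y.erase z.2), f 0 z' *
        et ((X.erase z.1).erase z'.1) ((Y.erase z.2).erase z'.2) (n + 1) (Fin.tail f)) /
          (((X.erase z.1).card : ℝ) * (Y.erase z.2).card) =
        (∑ z' ∈ (X.erase z.1) ×ˢ (Y.erase z.2), f 0 z' *
          et ((X.erase z.1).erase z'.1) ((Y.erase z.2).erase z'.2) (n + 1) (Fin.tail f)) /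
          (((X.card - 1 : ℕ) : ℝ) * ((Y.card - 1 : ℕ) : ℝ)) := by
      intro z hz
      rw [card_erase_mul_card_erase hz]
    rw [sum_congr rfl hB, ← sum_div, sum_offGrid_comm]
    have hC : ∀ z ∈ X ×ˢ Y, ∑ z' ∈ (X.erase z.1) ×ˢ (Y.erase z.2), f 0 z *
        et ((X.erase z'.1).erase z.1) ((Y.erase z'.2).erase z.2) (n + 1) (Fin.tail f) =
        f 0 z * ((((X.card - 1 : ℕ) : ℝ) * ((Y.card - 1 : ℕ) : ℝ)) *
          et (X.erase z.1) (Y.erase z.2) (n + 1) (Fin.tail f)) := by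
      intro z hz
      rw [← mul_sum]
      congr 1
      have hcomm : ∀ z' ∈ (X.erase z.1) ×ˢ (Y.erase z.2),
          et ((X.erase z'.1).erase z.1) ((Y.erase z'.2).erase z.2) (n + 1) (Fin.tail f) =
            et ((X.erase z.1).erase z'.1) ((Y.erase z.2).erase z'.2) (n + 1) (Fin.tail f) := by
        intro z' _
        rw [erase_erase_comm_fst X z' z, show (Y.erase z'.2).erase z.2 = (Y.erase z.2).erase z'.2 from
          Finset.erase_right_comm]
      rw [sum_congr rfl hcomm, ← card_erase_mul_card_erase hz]
      rw [Finset.mem_product] at hz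
      exact et_sum_erase (n + 1) (X.erase z.1) (Y.erase z.2) (Fin.tail f)
        (by rw [card_erase_of_mem hz.1]; omega) (by rw [card_erase_of_mem hz.2]; omega)
    rw [sum_congr rfl hC]
    have hD : ∑ z ∈ X ×ˢ Y, f 0 z * ((((X.card - 1 : ℕ) : ℝ) * ((Y.card - 1 : ℕ) : ℝ)) *
        et (X.erase z.1) (Y.erase z.2) (n + 1) (Fin.tail f)) =
        (((X.card - 1 : ℕ) : ℝ) * ((Y.card - 1 : ℕ) : ℝ)) *
          ∑ z ∈ X ×ˢ Y, f 0 z * et (X.erase z.1) (Y.erase z.2) (n + 1) (Fin.tail f) := by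
      rw [mul_sum]
      exact sum_congr rfl fun z _ => by ring
    rw [hD, mul_div_cancel_left₀ _ (mul_ne_zero h3 h4), mul_sub, mul_div_cancel₀ _ (mul_ne_zero hX0 hY0)]

/-! ### The chain case: full-width bands and `chainAvg` -/

/-- Exchanging two deleted points of one coordinate (plumbing). [this work] -/
theorem sum_erase_comm' (Y : Finset β) (F : β → β → ℝ) :
    ∑ y ∈ Y, ∑ y' ∈ Y.erase y, F y y' = ∑ y ∈ Y, ∑ y' ∈ Y.erase y, F y' y := by
  rw [Finset.sum_comm' (t' := Y) (s' := fun y' => Y.erase y')]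
  intro y y'
  simp only [Finset.mem_erase]
  tauto

/-- **Deletion averaging for `chainAvg`**: `Σ_{y∈Y} chainAvg (Y∖y) n h = |Y| · chainAvg Y n h` when `n + 1 ≤ |Y|`. [this work] -/
theorem chainAvg_sum_erase : ∀ (n : ℕ) (Y : Finset β) (h : Fin n → β → ℝ), n + 1 ≤ Y.card →
    ∑ y ∈ Y, chainAvg (Y.erase y) n h = (Y.card : ℝ) * chainAvg Y n h
  | 0, Y, h, _ => by simp [chainAvg_zero]
  | 1, Y, h, hY => by
    have hY0 : (Y.card : ℝ) ≠ 0 := by exact_mod_cast (show Y.card ≠ 0 by omega)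
    have h1 : ((Y.card - 1 : ℕ) : ℝ) ≠ 0 := by exact_mod_cast (show Y.card - 1 ≠ 0 by omega)
    simp only [chainAvg_one]
    rw [mul_div_cancel₀ _ hY0]
    have hc : ∀ y ∈ Y, (∑ y' ∈ Y.erase y, h 0 y') / ((Y.erase y).card : ℝ) =
        (∑ y' ∈ Y.erase y, h 0 y') / ((Y.card - 1 : ℕ) : ℝ) := by
      intro y hy
      rw [card_erase_of_mem hy]
    rw [sum_congr rfl hc, ← sum_div, sum_erase_comm']
    have hd : ∀ y ∈ Y, ∑ y' ∈ Y.erase y, h 0 y = ((Y.card - 1 : ℕ) : ℝ) * h 0 y := by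
      intro y hy
      rw [sum_const, card_erase_of_mem hy, nsmul_eq_mul]
    rw [sum_congr rfl hd, ← mul_sum, mul_div_cancel_left₀ _ h1]
  | n + 2, Y, h, hY => by
    have hY0 : (Y.card : ℝ) ≠ 0 := by exact_mod_cast (show Y.card ≠ 0 by omega)
    have h1 : ((Y.card - 1 : ℕ) : ℝ) ≠ 0 := by exact_mod_cast (show Y.card - 1 ≠ 0 by omega)
    simp only [chainAvg_succ_succ]
    rw [mul_div_cancel₀ _ hY0]
    have hc : ∀ y ∈ Y, (∑ y' ∈ Y.erase y, (((n : ℝ) + 1) - h 0 y') * chainAvg ((Y.erase y).erase y') (n + 1) (Fin.tail h)) /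
        ((Y.erase y).card : ℝ) =
        (∑ y' ∈ Y.erase y, (((n : ℝ) + 1) - h 0 y') * chainAvg ((Y.erase y).erase y') (n + 1) (Fin.tail h)) /
          ((Y.card - 1 : ℕ) : ℝ) := by
      intro y hy
      rw [card_erase_of_mem hy]
    rw [sum_congr rfl hc, ← sum_div, sum_erase_comm']
    have hd : ∀ y ∈ Y, ∑ y' ∈ Y.erase y, (((n : ℝ) + 1) - h 0 y) * chainAvg ((Y.erase y').erase y) (n + 1) (Fin.tail h) =
        (((n : ℝ) + 1) - h 0 y) * (((Y.card - 1 : ℕ) : ℝ) * chainAvg (Y.erase y) (n + 1) (Fin.tail h)) := by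
      intro y hy
      rw [← mul_sum]
      congr 1
      have hcomm : ∀ y' ∈ Y.erase y, chainAvg ((Y.erase y').erase y) (n + 1) (Fin.tail h) =
          chainAvg ((Y.erase y).erase y') (n + 1) (Fin.tail h) := by
        intro y' _
        rw [Finset.erase_right_comm]
      rw [sum_congr rfl hcomm, ← card_erase_of_mem hy]
      exact chainAvg_sum_erase (n + 1) (Y.erase y) (Fin.tail h) (by rw [card_erase_of_mem hy]; omega)
    rw [sum_congr rfl hd]
    have he : ∑ y ∈ Y, (((n : ℝ) + 1) - h 0 y) * (((Y.card - 1 : ℕ) : ℝ) * chainAvg (Y.erase y) (n + 1) (Fin.tail h)) =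
        ((Y.card - 1 : ℕ) : ℝ) * ∑ y ∈ Y, (((n : ℝ) + 1) - h 0 y) * chainAvg (Y.erase y) (n + 1) (Fin.tail h) := by
      rw [mul_sum]
      exact sum_congr rfl fun y _ => by ring
    rw [he, mul_div_cancel_left₀ _ h1]

/-- **`chainAvg` is nonnegative** for families with values in `[0,1]` on `Y`. [this work] -/
theorem chainAvg_nonneg : ∀ (n : ℕ) (Y : Finset β) (g : Fin n → β → ℝ),
    (∀ i, ∀ y ∈ Y, 0 ≤ g i y) → (∀ i, ∀ y ∈ Y, g i y ≤ 1) → 0 ≤ chainAvg Y n g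
  | 0, _, _, _, _ => le_rfl
  | 1, Y, g, h0, _ => by
    rw [chainAvg_one]
    exact div_nonneg (sum_nonneg fun y hy => h0 0 y hy) (Nat.cast_nonneg _)
  | n + 2, Y, g, h0, h1 => by
    rw [chainAvg_succ_succ]
    refine div_nonneg (sum_nonneg fun y hy => mul_nonneg ?_ ?_) (Nat.cast_nonneg _)
    · have := h1 0 y hy
      have hn : (0 : ℝ) ≤ n := Nat.cast_nonneg n
      linarith
    · exact chainAvg_nonneg (n + 1) (Y.erase y) (Fin.tail g)
        (fun i y' hy' => h0 i.succ y' (Finset.mem_of_mem_erase hy'))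
        (fun i y' hy' => h1 i.succ y' (Finset.mem_of_mem_erase hy'))

/-- **The chain case.**  For an ABSORBING family of functions of the second coordinate only (`g_j · g_i = g_j` for `i < j`:
e.g. indicators of nested sets `V_0 ⊇ V_1 ⊇ ⋯`), `Ẽ_n` on `X × Y` is the chain average `chainAvg Y n g` — the
without-replacement form of the Lieb–Sahi chain product formula. [this work] -/
theorem et_eq_chainAvg : ∀ (n : ℕ) (X : Finset α) (Y : Finset β) (g : Fin n → β → ℝ),
    (∀ i j : Fin n, i < j → g j * g i = g j) → n ≤ X.card → n ≤ Y.card →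
      et X Y n (fun i => g i ∘ Prod.snd) = chainAvg Y n g
  | 0, _, _, _, _, _, _ => rfl
  | 1, X, Y, g, _, hX, _ => by
    have hX0 : (X.card : ℝ) ≠ 0 := by exact_mod_cast (show X.card ≠ 0 by omega)
    rw [et_one, chainAvg_one, Finset.sum_product]
    simp only [Function.comp_apply, sum_const, nsmul_eq_mul]
    rw [mul_div_mul_left _ _ hX0]
  | n + 2, X, Y, g, habs, hX, hY => by
    have hX0 : (X.card : ℝ) ≠ 0 := by exact_mod_cast (show X.card ≠ 0 by omega)
    have hY0 : (Y.card : ℝ) ≠ 0 := by exact_mod_cast (show Y.card ≠ 0 by omega)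
    have htabs : ∀ i j : Fin (n + 1), i < j → Fin.tail g j * Fin.tail g i = Fin.tail g j :=
      fun i j hij => habs i.succ j.succ (Fin.succ_lt_succ_iff.2 hij)
    rw [et_succ_succ, chainAvg_succ_succ]
    -- the head is absorbed: every updated family is the tail itself
    have htl : (Fin.tail fun i => (g i ∘ Prod.snd : α × β → ℝ)) = fun j => (Fin.tail g j ∘ Prod.snd : α × β → ℝ) := rfl
    have hupd : ∀ i : Fin (n + 1), update (Fin.tail fun i => (g i ∘ Prod.snd : α × β → ℝ)) i
        (Fin.tail (fun i => (g i ∘ Prod.snd : α × β → ℝ)) i * (g 0 ∘ Prod.snd)) =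
        fun j => (Fin.tail g j ∘ Prod.snd : α × β → ℝ) := by
      intro i
      have hi : Fin.tail (fun i => (g i ∘ Prod.snd : α × β → ℝ)) i * (g 0 ∘ Prod.snd) =
          (Fin.tail g i ∘ Prod.snd : α × β → ℝ) := by
        funext z
        have := congrFun (habs 0 i.succ (Fin.succ_pos i)) z.2
        simpa [Fin.tail] using this
      rw [hi, htl]
      exact update_eq_self i _
    simp only [hupd, sum_const, card_univ, Fintype.card_fin, nsmul_eq_mul, Nat.cast_add, Nat.cast_one]
    rw [htl, et_eq_chainAvg (n + 1) X Y (Fin.tail g) htabs (by omega) (by omega)]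
    -- the product term: reduced grids, chain average of the tail, then deletion averaging
    have hprod : ∀ z ∈ X ×ˢ Y, (g 0 ∘ Prod.snd : α × β → ℝ) z * et (X.erase z.1) (Y.erase z.2) (n + 1)
        (fun j => (Fin.tail g j ∘ Prod.snd : α × β → ℝ)) = g 0 z.2 * chainAvg (Y.erase z.2) (n + 1) (Fin.tail g) := by
      intro z hz
      rw [Finset.mem_product] at hz
      rw [et_eq_chainAvg (n + 1) (X.erase z.1) (Y.erase z.2) (Fin.tail g) htabs
        (by rw [card_erase_of_mem hz.1]; omega) (by rw [card_erase_of_mem hz.2]; omega)]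
      rfl
    rw [sum_congr rfl hprod, Finset.sum_product]
    simp only [sum_const, nsmul_eq_mul]
    have hsplit : ∑ y ∈ Y, (((n : ℝ) + 1) - g 0 y) * chainAvg (Y.erase y) (n + 1) (Fin.tail g) =
        ((n : ℝ) + 1) * ∑ y ∈ Y, chainAvg (Y.erase y) (n + 1) (Fin.tail g) -
          ∑ y ∈ Y, g 0 y * chainAvg (Y.erase y) (n + 1) (Fin.tail g) := by
      rw [mul_sum, ← sum_sub_distrib]
      exact sum_congr rfl fun y _ => by ring
    rw [mul_div_mul_left _ _ hX0, hsplit, chainAvg_sum_erase (n + 1) Y (Fin.tail g) (by omega)]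
    field_simp


end SahiTwoChain

end Summit.CriticalPhenomena.PercolationContinuityZ3.Theorems
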